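import Literature.Analysis.FluidPDE.LeiZhang2011EnergyAxis
import Literature.Analysis.FluidPDE.LeiZhang2011SliceEstimates
import HarnessLib

/-!
# Lei–Zhang 2011, Lemma 3.4: the lower bound of the axis boundary term (analytic core)

Analysis/FluidPDE proofs file (theorems only), on the discharge path of the named fact
`Literature.Analysis.FluidPDE.LeiZhang2011_liouville` (Z. Lei, Q. S. Zhang, J. Funct. Anal. 261
(2011) = arXiv:1011.5066, Lemma 3.4, p. 11). Testing the equation for the positive normalised
solution `Φ` (equal to a constant `a ≥ 1` on the axis) with `pΦ^{p−1}ψ²`, `p < 1`, the axis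
term produces the positive boundary contribution `∫ds∫ 2Φ^p ψ²|_{r=0} dz` ((3.20):
"`−∬(2/r)(∂ᵣΦ^p)ψ² = ∬ Φ^p (4/|y'|)ψ∂_{|y'|}ψ + ∫ds∫2Φ^pψ²|_{r=0}dz ≥ −C∬Φ^p + (3/2)a^p`"),
and all other terms are bounded by powers of `L^q` norms of `Φ` over the cylinder
((3.21)–(3.24)). In the tree the computation is run through `energy_identity_axis` with a
time cut-off vanishing at both ends, for a positive `H ∈ C²` with a continuous weight `Gw ≥ 0`,
`H'² ≤ κ H Gw`, and `H'' = −Gw` on the range (`H = v^p`: `Gw = p(1−p)v^{p−2}`,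
`κ = p/(1−p)`): `LeiZhang2011.lower_mass_core` bounds the time integral of the boundary term
`η · 2c₂ ∫ H(F(s,0,0,z)) φ(0,0,z)² dz` by
`∫ ((4κD² + C_ax + D') ∫_K H(F) + 4κ D² C_J6 (∫_K H(F)^{3/2})^{2/3}) ds`.

## References

* Z. Lei, Q. S. Zhang, J. Funct. Anal. 261 (2011) = arXiv:1011.5066, Lemma 3.4 and its proof,
  (3.19)–(3.24), p. 11. [LeiZhang2011]
-/

noncomputable section

open MeasureTheory Set Function Filter Metric intervalIntegral
open _root_.Topology
open scoped InnerProductSpace RealInnerProductSpace NNReal ENNReal Laplacian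

namespace Literature.Analysis.FluidPDE

namespace LeiZhang2011

open Literature.Analysis.FunctionSpaces

/-- The real arithmetic of the pointwise-in-time bound in `lower_mass_core`. [folklore] -/
theorem lower_mass_arith {η Bd I G₁ T₁ T₂ T₃ M dη Gt A Y23 κ D Cax D' CJ6 P Q : ℝ}
    (hI : I = η * (-(G₁ + T₁) + T₂ + (T₃ + Bd)) + dη * M) (hG : G₁ = -Gt) (hGt : 0 ≤ Gt)
    (hη0 : 0 ≤ η) (hη1 : η ≤ 1) (hκ : 0 ≤ κ) (hA : 0 ≤ A) (hY : 0 ≤ Y23) (hCax : 0 ≤ Cax)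
    (hCJ6 : 0 ≤ CJ6) (hD' : 0 ≤ D')
    (h1 : |T₁| ≤ 1 / 4 * Gt + 4 * κ * P) (h2 : |T₂| ≤ 1 / 4 * Gt + 4 * κ * Q) (h3 : |T₃| ≤ Cax * A)
    (hMA : M ≤ A) (hM0 : 0 ≤ M) (hdη : |dη| ≤ D') (hP : P ≤ D ^ 2 * A) (hQ : Q ≤ D ^ 2 * CJ6 * Y23) :
    η * Bd ≤ I + ((4 * κ * D ^ 2 + Cax + D') * A + 4 * κ * D ^ 2 * CJ6 * Y23) := by
  have hT1 : T₁ ≤ 1 / 4 * Gt + 4 * κ * (D ^ 2 * A) := by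
    have := (le_abs_self _).trans h1
    nlinarith [mul_le_mul_of_nonneg_left hP (by positivity : (0:ℝ) ≤ 4 * κ)]
  have hT2 : -T₂ ≤ 1 / 4 * Gt + 4 * κ * (D ^ 2 * CJ6 * Y23) := by
    have := (neg_le_abs _).trans h2
    nlinarith [mul_le_mul_of_nonneg_left hQ (by positivity : (0:ℝ) ≤ 4 * κ)]
  have hT3 : -T₃ ≤ Cax * A := (neg_le_abs _).trans h3
  have hηM : -(dη * M) ≤ D' * A := by
    have h1 : -(dη * M) ≤ |dη| * M := by
      have := neg_abs_le dη; nlinarith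
    exact h1.trans (mul_le_mul hdη hMA hM0 hD')
  set W : ℝ := 4 * κ * (D ^ 2 * A) + 4 * κ * (D ^ 2 * CJ6 * Y23) + Cax * A with hW
  have hW0 : 0 ≤ W := by positivity
  have hbr : η * (-Gt + T₁ - T₂ - T₃) ≤ W := by
    have hle : -Gt + T₁ - T₂ - T₃ ≤ W := by linarith
    calc η * (-Gt + T₁ - T₂ - T₃) ≤ η * W := mul_le_mul_of_nonneg_left hle hη0
      _ ≤ 1 * W := mul_le_mul_of_nonneg_right hη1 hW0
      _ = W := one_mul _
  have halg : η * Bd = I + η * (G₁ + T₁ - T₂ - T₃) - dη * M := by rw [hI]; ring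
  rw [halg, hG]
  have : W + D' * A = (4 * κ * D ^ 2 + Cax + D') * A + 4 * κ * D ^ 2 * CJ6 * Y23 := by rw [hW]; ring
  linarith

/-- **Lemma 3.4 of Lei–Zhang 2011, analytic core.** In the setting of `energy_identity_axis`
on `[−T₁, 0]` (no vanishing on the axis), for a positive `H ∈ C²` with a continuous weight
`Gw ≥ 0` such that `H'² ≤ κ H Gw` and `H''(F) = −Gw(F)` on `[−T₁,0] × K`, an axisymmetric
cut-off `φ ∈ C²_c` supported in the compact `K` with `0 ≤ φ ≤ 1`, `‖∇φ‖ ≤ D` and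
`|(2/r)∂ᵣ(φ²)| ≤ C_ax φ`, a time cut-off `η ∈ C¹`, `η(−T₁) = η(0) = 0`, `0 ≤ η ≤ 1`,
`|η'| ≤ D'`, the space–time integrability of the tested equation, the slice functionals
integrable in time, and the John–Nirenberg `L⁶` bound `C_J6` of the stream oscillation on `K`:
the time integral of the axis boundary term is controlled by the cut-off terms,
`∫ η · 2c₂ ∫ H(F(s,0,0,z))φ(0,0,z)² dz ds ≤ ∫ ((4κD² + C_ax + D') ∫_K H(F(s)) + 4κD²C_J6 (∫_K H(F(s))^{3/2})^{2/3}) ds`.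
[cite: LeiZhang2011, proof of Lemma 3.4, (3.19)–(3.24) (arXiv p. 11)] -/
theorem lower_mass_core {T₁ : ℝ} (hT₁ : 0 < T₁)
    {F N : ℝ → EuclideanSpace ℝ (Fin 3) → ℝ}
    {b Bst : ℝ → EuclideanSpace ℝ (Fin 3) → EuclideanSpace ℝ (Fin 3)}
    {c : ℝ → EuclideanSpace ℝ (Fin 3)}
    (hF2 : ∀ s, ContDiff ℝ 2 (F s)) (hFa : ∀ s, IsAxisymmetricScalar (F s))
    (hb : ∀ s, LocallyIntegrable (b s) volume)
    (hBst : ∀ᵐ s ∂(volume.restrict (Ioc (-T₁) 0)),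
      Differentiable ℝ (Bst s) ∧ curl (Bst s) =ᵐ[volume] b s)
    (hN : ∀ s x, N s x =
      (Δ (F s)) x - fderiv ℝ (F s) x (b s x) - 2 / cylRadius x * fderiv ℝ (F s) x (eR x))
    (heq : ∀ᵐ x ∂(volume : Measure (EuclideanSpace ℝ (Fin 3))),
      IntervalIntegrable (fun s => N s x) volume (-T₁) 0 ∧
        ∀ s ∈ Icc (-T₁) 0, F s x = F (-T₁) x + ∫ τ in (-T₁)..s, N τ x)
    -- the nonlinearity and its weight
    {H Gw : ℝ → ℝ} (hH : ContDiff ℝ 2 H) (hHpos : ∀ v, 0 < H v) (hGwc : Continuous Gw)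
    (hGw0 : ∀ v, 0 ≤ Gw v) {κ : ℝ} (hκ0 : 0 ≤ κ) (hκ : ∀ v, deriv H v ^ 2 ≤ κ * H v * Gw v)
    {K : Set (EuclideanSpace ℝ (Fin 3))} (hKc : IsCompact K)
    (hG : ∀ s ∈ Icc (-T₁) 0, ∀ x ∈ K, deriv (deriv H) (F s x) = -Gw (F s x))
    -- the cut-offs
    {φ : EuclideanSpace ℝ (Fin 3) → ℝ} (hφ : ContDiff ℝ 2 φ) (hφc : HasCompactSupport φ)
    (hφa : IsAxisymmetricScalar φ) (hφK : tsupport φ ⊆ K)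
    (hφ01 : ∀ x, 0 ≤ φ x ∧ φ x ≤ 1) {D : ℝ} (hφD : ∀ x, ‖gradient φ x‖ ≤ D)
    {Cax : ℝ} (hCax : 0 ≤ Cax)
    (hφax : ∀ x, |2 / cylRadius x * fderiv ℝ (fun y => φ y ^ 2) x (eR x)| ≤ Cax * φ x)
    {η : ℝ → ℝ} (hη : ContDiff ℝ 1 η) (hη1 : η (-T₁) = 0) (hη2 : η 0 = 0)
    (hη01 : ∀ s, 0 ≤ η s ∧ η s ≤ 1) {D' : ℝ} (hηD : ∀ s, |deriv η s| ≤ D')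
    -- space–time integrability of the tested equation
    (hint : Integrable (fun p : ℝ × EuclideanSpace ℝ (Fin 3) =>
      (deriv H (F p.1 p.2) * N p.1 p.2 * η p.1 + H (F p.1 p.2) * deriv η p.1) * φ p.2 ^ 2)
      ((volume.restrict (Ioc (-T₁) 0)).prod volume))
    -- the slice functionals
    {G₁ T₁f T₂f T₃f M Bd : ℝ → ℝ}
    (hG₁ : ∀ s, G₁ s = ∫ x, deriv (deriv H) (F s x) * ‖gradient (F s) x‖ ^ 2 * φ x ^ 2)
    (hT₁f : ∀ s, T₁f s = ∫ x, deriv H (F s x) * ⟪gradient (F s) x, gradient (fun y => φ y ^ 2) x⟫)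
    (hT₂f : ∀ s, T₂f s = ∫ x, H (F s x) * ⟪b s x, gradient (fun y => φ y ^ 2) x⟫)
    (hT₃f : ∀ s, T₃f s = ∫ x, 2 / cylRadius x * (H (F s x) * fderiv ℝ (fun y => φ y ^ 2) x (eR x)))
    (hM : ∀ s, M s = ∫ x, H (F s x) * φ x ^ 2)
    (hBd : ∀ s, Bd s = 2 * radialConst₂ *
      ∫ z : ℝ, H (F s (meridianPoint (0, z))) * φ (meridianPoint (0, z)) ^ 2)
    (hG₁i : IntervalIntegrable G₁ volume (-T₁) 0) (hT₁i : IntervalIntegrable T₁f volume (-T₁) 0)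
    (hT₂i : IntervalIntegrable T₂f volume (-T₁) 0) (hT₃i : IntervalIntegrable T₃f volume (-T₁) 0)
    (hMi : IntervalIntegrable M volume (-T₁) 0) (hBdi : IntervalIntegrable Bd volume (-T₁) 0)
    -- the John–Nirenberg `L⁶` bound of the stream oscillation over `K`
    {CJ6 : ℝ} (hCJ6 : 0 ≤ CJ6)
    (hc : ∀ᵐ s ∂(volume.restrict (Ioc (-T₁) 0)),
      (∫ x in K, (‖Bst s x - c s‖ ^ 2) ^ (3 : ℝ)) ^ (1 / (3 : ℝ)) ≤ CJ6)
    -- joint continuity of `H(F)`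
    (hHFc : Continuous fun p : ℝ × EuclideanSpace ℝ (Fin 3) => H (F p.1 p.2)) :
    ∫ s in (-T₁)..0, η s * Bd s ≤
      ∫ s in (-T₁)..0, ((4 * κ * D ^ 2 + Cax + D') * (∫ x in K, H (F s x)) +
        4 * κ * D ^ 2 * CJ6 * (∫ x in K, H (F s x) ^ ((3 : ℝ) / 2)) ^ (2 / (3 : ℝ))) := by
  have ht₁ : -T₁ ≤ (0 : ℝ) := by linarith
  have hH0 : ∀ v, 0 ≤ H v := fun v => (hHpos v).le
  have hH1 : ContDiff ℝ 1 H := hH.of_le one_le_two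
  have hD0 : 0 ≤ D := (norm_nonneg _).trans (hφD 0)
  have hD'0 : 0 ≤ D' := (abs_nonneg _).trans (hηD 0)
  -- support facts
  have hφ0K : ∀ x, x ∉ K → φ x = 0 := fun x hx => image_eq_zero_of_notMem_tsupport fun h => hx (hφK h)
  have hgradφ0 : ∀ x, x ∉ K → gradient φ x = 0 := fun x hx =>
    gradient_eq_zero_of_notMem_tsupport fun h => hx (hφK h)
  have hHFs : ∀ s, Continuous fun x => H (F s x) := fun s => hH.continuous.comp (hF2 s).continuous
  -- ### Step 1: the identity, whose left-hand side vanishes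
  have hid := energy_identity_axis ht₁ hF2 hFa hb hBst hN heq hH hφ hφc hφa hη hint
  have hLHS : ∫ x, (H (F 0 x) * η 0 - H (F (-T₁) x) * η (-T₁)) * φ x ^ 2 = 0 := by
    simp [hη1, hη2]
  rw [hLHS] at hid
  -- the identity's integrand through the slice functionals
  obtain ⟨I, hI⟩ : ∃ I : ℝ → ℝ, ∀ s, I s =
      η s * (-(G₁ s + T₁f s) + T₂f s + (T₃f s + Bd s)) + deriv η s * M s := ⟨_, fun _ => rfl⟩
  have hIint : ∫ s in (-T₁)..0, I s = 0 := by
    refine Eq.trans ?_ hid.symm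
    refine intervalIntegral.integral_congr fun s _ => ?_
    have hiG : Integrable (fun x => deriv (deriv H) (F s x) * ‖gradient (F s) x‖ ^ 2 * φ x ^ 2)
        (volume : Measure (EuclideanSpace ℝ (Fin 3))) := by
      have hH'' : Continuous (deriv (deriv H)) := by
        have h2 : ContDiff ℝ (1 + 1) H := by rw [one_add_one_eq_two]; exact hH
        exact h2.deriv'.continuous_deriv le_rfl
      exact (((hH''.comp (hF2 s).continuous).mul
        ((continuous_gradient_of_contDiff ((hF2 s).of_le one_le_two)).norm.pow 2)).mul
          (hφ.continuous.pow 2)).integrable_of_hasCompactSupport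
            ((hφc.comp_left (g := fun t : ℝ => t ^ 2) (zero_pow two_ne_zero)).mul_left)
    have hiT : Integrable (fun x => deriv H (F s x) * ⟪gradient (F s) x, gradient (fun y => φ y ^ 2) x⟫)
        (volume : Measure (EuclideanSpace ℝ (Fin 3))) := by
      have hgradφ2 : Continuous (gradient fun y => φ y ^ 2) :=
        continuous_gradient_of_contDiff ((hφ.pow 2).of_le (by norm_num))
      have hgradφ2c : HasCompactSupport (gradient fun y => φ y ^ 2) :=
        HasCompactSupport.intro (hφc.comp_left (g := fun t : ℝ => t ^ 2) (zero_pow two_ne_zero))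
          fun x hx => gradient_eq_zero_of_notMem_tsupport hx
      exact (((hH.continuous_deriv (by norm_num)).comp (hF2 s).continuous).mul
        ((continuous_gradient_of_contDiff ((hF2 s).of_le one_le_two)).inner hgradφ2)).integrable_of_hasCompactSupport
          (hgradφ2c.mono fun x hx => by
            contrapose! hx
            simp only [mem_support, not_not] at hx ⊢
            show deriv H (F s x) * ⟪gradient (F s) x, gradient (fun y => φ y ^ 2) x⟫ = 0
            rw [hx, inner_zero_right, mul_zero])
    have hsplit : ∫ x, (deriv (deriv H) (F s x) * ‖gradient (F s) x‖ ^ 2 * φ x ^ 2 +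
        deriv H (F s x) * ⟪gradient (F s) x, gradient (fun y => φ y ^ 2) x⟫) = G₁ s + T₁f s := by
      rw [hG₁ s, hT₁f s, ← integral_add hiG hiT]
    rw [hI s, ← hsplit, hT₂f s, hT₃f s, hM s, hBd s]
  -- ### Step 2: the pointwise-in-time bound, for a.e. `s ∈ (−T₁, 0]`
  set A : ℝ → ℝ := fun s => ∫ x in K, H (F s x) with hA
  set Y : ℝ → ℝ := fun s => ∫ x in K, H (F s x) ^ ((3 : ℝ) / 2) with hY
  set R : ℝ → ℝ := fun s => (4 * κ * D ^ 2 + Cax + D') * A s + 4 * κ * D ^ 2 * CJ6 * Y s ^ (2 / (3 : ℝ))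
    with hR
  have hA0 : ∀ s, 0 ≤ A s := fun s => integral_nonneg fun x => hH0 _
  have hY0 : ∀ s, 0 ≤ Y s := fun s => integral_nonneg fun x => Real.rpow_nonneg (hH0 _) _
  -- `M ≤ A`, `P ≤ D² A`
  have hMle : ∀ s, M s ≤ A s := by
    intro s
    rw [hM s, ← setIntegral_eq_integral_of_forall_compl_eq_zero (s := K) (fun x hx => by
      rw [hφ0K x hx]; ring)]
    refine setIntegral_mono_on (((hHFs s).mul (hφ.continuous.pow 2)).continuousOn.integrableOn_compact hKc)
      ((hHFs s).continuousOn.integrableOn_compact hKc) hKc.measurableSet fun x _ => ?_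
    have h1 : φ x ^ 2 ≤ 1 := by have := hφ01 x; nlinarith
    calc H (F s x) * φ x ^ 2 ≤ H (F s x) * 1 := mul_le_mul_of_nonneg_left h1 (hH0 _)
      _ = H (F s x) := mul_one _
  have hM0 : ∀ s, 0 ≤ M s := fun s => by
    rw [hM s]; exact integral_nonneg fun x => mul_nonneg (hH0 _) (sq_nonneg _)
  have hPle : ∀ s, ∫ x, H (F s x) * ‖gradient φ x‖ ^ 2 ≤ D ^ 2 * A s := by
    intro s
    rw [← setIntegral_eq_integral_of_forall_compl_eq_zero (s := K) (fun x hx => by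
      rw [hgradφ0 x hx, norm_zero]; ring), hA, ← MeasureTheory.integral_const_mul]
    have hgc : Continuous (gradient φ) := continuous_gradient_of_contDiff (hφ.of_le (by norm_num))
    refine setIntegral_mono_on (((hHFs s).mul (hgc.norm.pow 2)).continuousOn.integrableOn_compact hKc)
      ((continuous_const.mul (hHFs s)).continuousOn.integrableOn_compact hKc) hKc.measurableSet
      fun x _ => ?_
    have h1 : ‖gradient φ x‖ ^ 2 ≤ D ^ 2 := pow_le_pow_left₀ (norm_nonneg _) (hφD x) 2
    calc H (F s x) * ‖gradient φ x‖ ^ 2 ≤ H (F s x) * D ^ 2 := mul_le_mul_of_nonneg_left h1 (hH0 _)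
      _ = D ^ 2 * H (F s x) := by ring
  -- `|T₃| ≤ C_ax A`
  have hT₃le : ∀ s, |T₃f s| ≤ Cax * A s := by
    intro s
    rw [hT₃f s]
    have hgi : Integrable (fun x => Cax * (H (F s x) * φ x))
        (volume : Measure (EuclideanSpace ℝ (Fin 3))) :=
      ((continuous_const.mul ((hHFs s).mul hφ.continuous)).integrable_of_hasCompactSupport
        (hφc.mul_left.mul_left))
    have h := norm_integral_le_of_norm_le (μ := (volume : Measure (EuclideanSpace ℝ (Fin 3))))
      (f := fun x => 2 / cylRadius x * (H (F s x) * fderiv ℝ (fun y => φ y ^ 2) x (eR x))) hgi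
      (ae_of_all _ fun x => (by
        show ‖2 / cylRadius x * (H (F s x) * fderiv ℝ (fun y => φ y ^ 2) x (eR x))‖ ≤ Cax * (H (F s x) * φ x)
        rw [Real.norm_eq_abs, show 2 / cylRadius x * (H (F s x) * fderiv ℝ (fun y => φ y ^ 2) x (eR x)) =
          H (F s x) * (2 / cylRadius x * fderiv ℝ (fun y => φ y ^ 2) x (eR x)) by ring, abs_mul,
          abs_of_nonneg (hH0 _)]
        calc H (F s x) * |2 / cylRadius x * fderiv ℝ (fun y => φ y ^ 2) x (eR x)|
            ≤ H (F s x) * (Cax * φ x) := mul_le_mul_of_nonneg_left (hφax x) (hH0 _)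
          _ = Cax * (H (F s x) * φ x) := by ring))
    rw [Real.norm_eq_abs] at h
    refine h.trans ?_
    rw [MeasureTheory.integral_const_mul]
    refine mul_le_mul_of_nonneg_left ?_ hCax
    rw [← setIntegral_eq_integral_of_forall_compl_eq_zero (s := K) (fun x hx => by
      rw [hφ0K x hx, mul_zero])]
    refine setIntegral_mono_on (((hHFs s).mul hφ.continuous).continuousOn.integrableOn_compact hKc)
      ((hHFs s).continuousOn.integrableOn_compact hKc) hKc.measurableSet fun x _ => ?_
    calc H (F s x) * φ x ≤ H (F s x) * 1 := mul_le_mul_of_nonneg_left (hφ01 x).2 (hH0 _)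
      _ = H (F s x) := mul_one _
  -- `G₁ = −G̃` on `[−T₁, 0]`
  set Gt : ℝ → ℝ := fun s => ∫ x, Gw (F s x) * ‖gradient (F s) x‖ ^ 2 * φ x ^ 2 with hGt
  have hGt0 : ∀ s, 0 ≤ Gt s := fun s =>
    integral_nonneg fun x => mul_nonneg (mul_nonneg (hGw0 _) (sq_nonneg _)) (sq_nonneg _)
  have hG₁eq : ∀ s ∈ Icc (-T₁) 0, G₁ s = -Gt s := by
    intro s hs
    rw [hG₁ s, hGt, ← MeasureTheory.integral_neg]
    refine integral_congr_ae (ae_of_all _ fun x => ?_)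
    show deriv (deriv H) (F s x) * ‖gradient (F s) x‖ ^ 2 * φ x ^ 2 =
      -(Gw (F s x) * ‖gradient (F s) x‖ ^ 2 * φ x ^ 2)
    by_cases hx : x ∈ K
    · rw [hG s hs x hx]; ring
    · rw [hφ0K x hx]; ring
  have hbound : ∀ᵐ s ∂(volume.restrict (Ioc (-T₁) 0)), η s * Bd s ≤ I s + R s := by
    filter_upwards [hBst, hc, ae_restrict_mem measurableSet_Ioc] with s hBs hcs hs
    have hsI : s ∈ Icc (-T₁) 0 := Ioc_subset_Icc_self hs
    obtain ⟨hBd', hBcurl⟩ := hBs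
    have hηs := hη01 s
    -- `|T₁| ≤ ¼ G̃ + 4κ P`
    have h1 : |T₁f s| ≤ 1 / 4 * Gt s + 4 * κ * ∫ x, H (F s x) * ‖gradient φ x‖ ^ 2 := by
      have h := abs_integral_deriv_comp_inner_gradient_le_weight ((hF2 s).of_le one_le_two) hH1 hH0
        hGwc hGw0 hκ0 hκ (hφ.of_le one_le_two) hφc (ε := 1 / 4) (by norm_num)
      rwa [← hT₁f s, show κ / (1 / 4) = 4 * κ by ring] at h
    -- `|T₂| ≤ ¼ G̃ + 4κ Q`
    have h2 : |T₂f s| ≤ 1 / 4 * Gt s + 4 * κ * ∫ x, H (F s x) * ‖Bst s x - c s‖ ^ 2 * ‖gradient φ x‖ ^ 2 := by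
      have h := abs_integral_comp_inner_gradient_le_weight (hF2 s) hH1 hH0 hGwc hGw0 hκ0 hκ hφ hφc
        hBd' hBcurl (hb s) (c s) (ε := 1 / 4) (by norm_num)
      rwa [← hT₂f s, show κ / (1 / 4) = 4 * κ by ring] at h
    -- `Q ≤ D² C_J6 Y^{2/3}`
    have hQ : ∫ x, H (F s x) * ‖Bst s x - c s‖ ^ 2 * ‖gradient φ x‖ ^ 2 ≤ D ^ 2 * CJ6 * Y s ^ (2 / (3 : ℝ)) := by
      have h := integral_comp_mul_norm_sub_sq_mul_norm_gradient_sq_le (hF2 s).continuous hH.continuous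
        hH0 (hφ.of_le (by norm_num)) hKc hφK hφD hBd'.continuous (c s)
      refine h.trans ?_
      have e : (∫ x in K, H (F s x) ^ ((3 : ℝ) / 2)) ^ (1 / ((3 : ℝ) / 2)) = Y s ^ (2 / (3 : ℝ)) := by
        rw [hY]; norm_num
      rw [e]
      have hY23 : 0 ≤ Y s ^ (2 / (3 : ℝ)) := Real.rpow_nonneg (hY0 s) _
      calc D ^ 2 * ((∫ x in K, (‖Bst s x - c s‖ ^ 2) ^ (3 : ℝ)) ^ (1 / (3 : ℝ)) * Y s ^ (2 / (3 : ℝ)))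
          ≤ D ^ 2 * (CJ6 * Y s ^ (2 / (3 : ℝ))) := by gcongr
        _ = D ^ 2 * CJ6 * Y s ^ (2 / (3 : ℝ)) := by ring
    exact lower_mass_arith (hI s) (hG₁eq s hsI) (hGt0 s) hηs.1 hηs.2 hκ0 (hA0 s)
      (Real.rpow_nonneg (hY0 s) _) hCax hCJ6 hD'0 h1 h2 (hT₃le s) (hMle s) (hM0 s) (hηD s) (hPle s) hQ
  -- ### Step 3: integrate over `[−T₁, 0]`
  have hAc : Continuous A := continuous_parametric_integral_of_continuous
    (μ := (volume : Measure (EuclideanSpace ℝ (Fin 3)))) (f := fun s x => H (F s x)) hHFc hKc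
  have hYc : Continuous Y := continuous_parametric_integral_of_continuous
    (μ := (volume : Measure (EuclideanSpace ℝ (Fin 3))))
    (f := fun s x => H (F s x) ^ ((3 : ℝ) / 2)) (hHFc.rpow_const fun p => Or.inr (by norm_num)) hKc
  have hRc : Continuous R :=
    (continuous_const.mul hAc).add (continuous_const.mul (hYc.rpow_const fun s => Or.inr (by norm_num)))
  have hηc : Continuous η := hη.continuous
  have hη'c : Continuous (deriv η) := hη.continuous_deriv le_rfl
  have hIi : IntervalIntegrable I volume (-T₁) 0 := by
    have h := ((((hG₁i.add hT₁i).neg.add hT₂i).add (hT₃i.add hBdi)).continuousOn_mul hηc.continuousOn).add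
      (hMi.continuousOn_mul hη'c.continuousOn)
    refine h.congr_ae (Eventually.of_forall fun s => ?_)
    rw [hI s]
    simp only [Pi.neg_apply]
  have hLi : IntervalIntegrable (fun s => η s * Bd s) volume (-T₁) 0 := hBdi.continuousOn_mul hηc.continuousOn
  have hRi : IntervalIntegrable R volume (-T₁) 0 := hRc.intervalIntegrable _ _
  have hmono : ∫ s in (-T₁)..0, η s * Bd s ≤ ∫ s in (-T₁)..0, (I s + R s) := by
    refine intervalIntegral.integral_mono_ae_restrict ht₁ hLi (hIi.add hRi) ?_
    have hIe : (volume : Measure ℝ).restrict (Icc (-T₁) 0) = volume.restrict (Ioc (-T₁) 0) :=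
      Measure.restrict_congr_set Ioc_ae_eq_Icc.symm
    rw [Filter.EventuallyLE, hIe]
    exact hbound
  rw [intervalIntegral.integral_add hIi hRi, hIint, zero_add] at hmono
  exact hmono

end LeiZhang2011

end Literature.Analysis.FluidPDE
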